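import Literature.NumberTheory.Sieve.DrappeauDispersionS1PoissonWeighted
import Literature.NumberTheory.Sieve.DrappeauDispersionSmoothing
import Literature.NumberTheory.Sieve.DrappeauDispersionMainTermsTools
import HarnessLib

/-!
# Drappeau 2017, §5.4: counting lemmas for the trivial bound on the pieces `𝒮₁(q₀,n₀)`

Topic `Literature/NumberTheory/Sieve`, part of the formalisation of §5 of S. Drappeau, Proc. London
Math. Soc. (3) 114 (2017) 684–732 = arXiv:1504.05549 (Theorem 5.1 = the named fact
`Literature.NumberTheory.Sieve.Drappeau2017_theorem51`).  Everything here is PROVED; no definition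
and no named fact is introduced.

§5.4 (arXiv p. 19, "Second reduction") bounds the pieces `𝒮₁(q₀,n₀)` of `𝒮₁` with `(q₁,q₂) = q₀`,
`(n₁,n₂) = n₀` trivially: the number of `q₁` with `q₁ ∣ m a₂n₀n₁ − a₁ ≠ 0` is `≤ τ(|m a₂n₀n₁ − a₁|)`,
and the `m ≡ a₁\\overline{a₂n₀n₂} (q₀q₂)` in the support of `α` number `≪ M/(q₀q₂) + 1`.  The two
counting lemmas:

* `Drappeau2017.card_mRange_filter_kerArg_le` — `#{m ∈ mRange M (M/2) : m n ā₁a₂ ≡ 1 (s)} ≤ ⌊5M/2⌋/s + 1`;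
* `Drappeau2017.sum_ite_kerArg_le_sigma` — `∑_{q ∈ 𝒬, (q,a₁a₂)=1} 1_{m n ā₁ a₂ ≡ 1 (q)} ≤ τ(|m n a₂ − a₁|)`
  when `m n a₂ ≠ a₁`;

and their consequences for the pieces (weights `1_{(q₁,q₂)=q₀,(n₁,n₂)=n₀}` as in
`DrappeauDispersionS1PoissonWeighted`):

* `Drappeau2017.norm_S1piece_le` — the trivial bound for `𝒮₁(q₀,n₀)`;
* `Drappeau2017.norm_X1piece_le` — the trivial bound for the main-term piece `X₁(q₀,n₀)`;
* `Drappeau2017.card_pairs_le` — `#{(n₁,n₂) : n₀ ∣ n_j ≤ X, n₁ ≡ n₂ (q₀)} ≤ (X/n₀+1)(X/(n₀q₀)+1)`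
  for `(n₀,q₀) = 1`;
* `Drappeau2017.S1piece_eq_zero`, `Drappeau2017.X1piece_eq_zero` — the pieces vanish unless
  `(q₀,n₀) = (q₀,a₁a₂) = (n₀,a₂) = 1`.

## References

* S. Drappeau, Proc. London Math. Soc. (3) 114 (2017) 684–732, arXiv:1504.05549, §5.4 (the bound
  `|𝒮₁(q₀,n₀)| ≪ x^ε {MN²/(n₀²q₀²) + MN/(n₀q₀)}`). [cite: Drappeau2017, §5.4]
-/

noncomputable section

open Finset Real
open scoped ArithmeticFunction.sigma

namespace Literature.NumberTheory.Sieve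

namespace Drappeau2017

/-- `m n ā₁ a₂ ≡ 1 (q)` iff `m (n a₂) ≡ a₁ (q)`, for `a₁` a unit modulo `q`. [folklore] -/
theorem kerArg_eq_one_iff (a₁ a₂ : ℤ) {q : ℕ} (ha₁ : IsUnit (a₁ : ZMod q)) (m n : ℕ) :
    kerArg a₁ a₂ q m n = 1 ↔ (m : ZMod q) * ((n : ZMod q) * (a₂ : ZMod q)) = (a₁ : ZMod q) := by
  unfold kerArg
  push_cast
  constructor
  · intro h
    calc (m : ZMod q) * ((n : ZMod q) * (a₂ : ZMod q))
        = (m : ZMod q) * n * a₂ * (((a₁ : ZMod q))⁻¹ * (a₁ : ZMod q)) := by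
          rw [ZMod.inv_mul_of_unit _ ha₁, mul_one]; ring
      _ = ((m : ZMod q) * n * ((a₁ : ZMod q))⁻¹ * (a₂ : ZMod q)) * (a₁ : ZMod q) := by ring
      _ = (a₁ : ZMod q) := by rw [h, one_mul]
  · intro h
    calc (m : ZMod q) * n * ((a₁ : ZMod q))⁻¹ * (a₂ : ZMod q)
        = ((m : ZMod q) * ((n : ZMod q) * (a₂ : ZMod q))) * ((a₁ : ZMod q))⁻¹ := by ring
      _ = 1 := by rw [h, ZMod.mul_inv_of_unit _ ha₁]

/-- **Counting `m` in the support of `α` in one class**: for `s ≥ 1` and fixed `n`: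
`#{m ∈ mRange M (M/2) : m n ā₁ a₂ ≡ 1 (s)} ≤ ⌊2M + M/2⌋ / s + 1`. [cite: Drappeau2017, §5.4] -/
theorem card_mRange_filter_kerArg_le (M : ℝ) {s : ℕ} (hs : 0 < s) (a₁ a₂ : ℤ) (n : ℕ) :
    ((BFI.mRange M (M / 2)).filter (fun m : ℕ => kerArg a₁ a₂ s m n = 1)).card ≤
      ⌊2 * M + M / 2⌋₊ / s + 1 := by
  set u : ZMod s := (n : ZMod s) * ((a₁ : ZMod s))⁻¹ * (a₂ : ZMod s) with hu
  have hU : ∀ m ∈ BFI.mRange M (M / 2), m ≤ ⌊2 * M + M / 2⌋₊ := fun m hm => (BFI.mem_mRange.1 hm)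
  refine le_trans (Finset.card_le_card ?_) (card_filter_natCast_eq_le hU hs u⁻¹)
  intro m hm
  rw [Finset.mem_filter] at hm ⊢
  refine ⟨hm.1, ?_⟩
  have h1 : (m : ZMod s) * u = 1 := by
    have h := hm.2
    unfold kerArg at h
    rw [hu, ← h]; push_cast; ring
  have hu' : IsUnit u := IsUnit.of_mul_eq_one_right _ h1
  calc (m : ZMod s) = (m : ZMod s) * (u * u⁻¹) := by rw [ZMod.mul_inv_of_unit u hu', mul_one]
    _ = u⁻¹ := by rw [← mul_assoc, h1, one_mul]

/-- **Counting the moduli `q₁`**: for a set `𝒬'` of moduli `q ≥ 1` coprime to `a₁a₂` and `m, n` with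
`m n a₂ ≠ a₁`, `∑_{q ∈ 𝒬'} 1_{m n ā₁ a₂ ≡ 1 (q)} ≤ τ(|m n a₂ − a₁|)` (each such `q` divides
`m n a₂ − a₁`). [cite: Drappeau2017, §5.4] -/
theorem sum_ite_kerArg_le_sigma {𝒬' : Finset ℕ} {a₁ a₂ : ℤ}
    (h𝒬' : ∀ q ∈ 𝒬', 0 < q ∧ IsCoprime (q : ℤ) (a₁ * a₂)) {m n : ℕ}
    (hk : (m : ℤ) * n * a₂ - a₁ ≠ 0) :
    ∑ q ∈ 𝒬', (if kerArg a₁ a₂ q m n = 1 then (1 : ℝ) else 0) ≤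
      (σ 0 (Int.natAbs ((m : ℤ) * n * a₂ - a₁)) : ℝ) := by
  rw [Finset.sum_boole, ArithmeticFunction.sigma_zero_apply]
  exact_mod_cast Finset.card_le_card (fun q hq => by
    rw [Finset.mem_filter] at hq
    obtain ⟨hq0, hcop⟩ := h𝒬' q hq.1
    have ha₁ : IsUnit (a₁ : ZMod q) := (isUnit_of_isCoprime_mul hcop).1
    have h := (kerArg_eq_one_iff a₁ a₂ ha₁ m n).1 hq.2
    have hdvd : (q : ℤ) ∣ (m : ℤ) * n * a₂ - a₁ := by
      rw [← ZMod.intCast_zmod_eq_zero_iff_dvd]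
      push_cast
      rw [← h]; ring
    rw [Nat.mem_divisors]
    exact ⟨Int.natCast_dvd.1 hdvd, Int.natAbs_ne_zero.2 hk⟩)

/-! ### The `m`-sum is real and small -/

/-- The `m`-sum of `𝒮₁` is a non-negative real `≤ #{m ∈ mRange : m n₂ ā₁a₂ ≡ 1 (q₂)} `-many units:
`‖∑_m α(m) 1_{(q₁)} 1_{(q₂)}‖ ≤ ∑_m α(m) 1_{m n₁ā₁a₂≡1 (q₁)} 1_{m n₂ā₁a₂≡1 (q₂)}` (real form). [folklore] -/
theorem norm_msum_le_real {M : ℝ} (hM : 0 < M) (a₁ a₂ : ℤ) (q₁ q₂ n₁ n₂ : ℕ) :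
    ‖∑ m ∈ BFI.mRange M (M / 2), ((BFI.bump M (M / 2) m : ℝ) : ℂ) *
        (if kerArg a₁ a₂ q₁ m n₁ = 1 then 1 else 0) * (if kerArg a₁ a₂ q₂ m n₂ = 1 then 1 else 0)‖ ≤
      ∑ m ∈ BFI.mRange M (M / 2), BFI.bump M (M / 2) m *
        ((if kerArg a₁ a₂ q₁ m n₁ = 1 then (1 : ℝ) else 0) *
          (if kerArg a₁ a₂ q₂ m n₂ = 1 then (1 : ℝ) else 0)) := by
  have hM2 : (0 : ℝ) < M / 2 := by linarith
  refine (norm_sum_le _ _).trans (Finset.sum_le_sum fun m _ => le_of_eq ?_)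
  have hb := (BFI.bump_mem_Icc hM2 hM.le (m : ℝ)).1
  rw [mul_assoc, norm_mul, Complex.norm_real, Real.norm_eq_abs, abs_of_nonneg hb]
  congr 1
  split_ifs <;> simp

/-- **The trivial bound for the `q₁`-sum of `m`-sums** (§5.4): for moduli `𝒬' ∋ q₁` (all `≥ 1`,
coprime to `a₁a₂`), `q₂ ≥ 1`, `M > 0` with `α(m) ≠ 0 ⇒ m n₁ a₂ ≠ a₁` and `τ(|m n₁a₂ − a₁|) ≤ τM`:
`∑_{q₁ ∈ 𝒬'} ∑_m α(m) 1_{mn₁ā₁a₂≡1 (q₁)} 1_{mn₂ā₁a₂≡1 (q₂)} ≤ τM (⌊5M/2⌋/q₂ + 1)`.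
[cite: Drappeau2017, §5.4] -/
theorem sum_msum_real_le {𝒬' : Finset ℕ} {a₁ a₂ : ℤ}
    (h𝒬' : ∀ q ∈ 𝒬', 0 < q ∧ IsCoprime (q : ℤ) (a₁ * a₂)) {q₂ : ℕ} (hq₂ : 0 < q₂) {M : ℝ}
    (hM : 0 < M) {n₁ : ℕ} (n₂ : ℕ) {τM : ℝ} (hτ0 : 0 ≤ τM)
    (hτ : ∀ m ∈ BFI.mRange M (M / 2), BFI.bump M (M / 2) m ≠ 0 →
      (m : ℤ) * n₁ * a₂ - a₁ ≠ 0 ∧ (σ 0 (Int.natAbs ((m : ℤ) * n₁ * a₂ - a₁)) : ℝ) ≤ τM) :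
    ∑ q₁ ∈ 𝒬', ∑ m ∈ BFI.mRange M (M / 2), BFI.bump M (M / 2) m *
        ((if kerArg a₁ a₂ q₁ m n₁ = 1 then (1 : ℝ) else 0) *
          (if kerArg a₁ a₂ q₂ m n₂ = 1 then (1 : ℝ) else 0)) ≤
      τM * (((⌊2 * M + M / 2⌋₊ / q₂ : ℕ) : ℝ) + 1) := by
  have hM2 : (0 : ℝ) < M / 2 := by linarith
  rw [Finset.sum_comm]
  -- pointwise in `m`
  have hstep : ∀ m ∈ BFI.mRange M (M / 2), ∑ q₁ ∈ 𝒬', BFI.bump M (M / 2) m *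
      ((if kerArg a₁ a₂ q₁ m n₁ = 1 then (1 : ℝ) else 0) *
        (if kerArg a₁ a₂ q₂ m n₂ = 1 then (1 : ℝ) else 0)) ≤
      τM * (if kerArg a₁ a₂ q₂ m n₂ = 1 then (1 : ℝ) else 0) := by
    intro m hm
    have hb := BFI.bump_mem_Icc hM2 hM.le (m : ℝ)
    by_cases hb0 : BFI.bump M (M / 2) m = 0
    · rw [hb0]; simp only [zero_mul, Finset.sum_const_zero]; positivity
    obtain ⟨hk, hσ⟩ := hτ m hm hb0
    have h1 := sum_ite_kerArg_le_sigma h𝒬' (n := n₁) hk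
    calc ∑ q₁ ∈ 𝒬', BFI.bump M (M / 2) m *
          ((if kerArg a₁ a₂ q₁ m n₁ = 1 then (1 : ℝ) else 0) *
            (if kerArg a₁ a₂ q₂ m n₂ = 1 then (1 : ℝ) else 0))
        = BFI.bump M (M / 2) m * (if kerArg a₁ a₂ q₂ m n₂ = 1 then (1 : ℝ) else 0) *
            ∑ q₁ ∈ 𝒬', (if kerArg a₁ a₂ q₁ m n₁ = 1 then (1 : ℝ) else 0) := by
          rw [Finset.mul_sum]
          refine Finset.sum_congr rfl fun q₁ _ => by ring
      _ ≤ 1 * (if kerArg a₁ a₂ q₂ m n₂ = 1 then (1 : ℝ) else 0) * τM := by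
          refine mul_le_mul (mul_le_mul_of_nonneg_right hb.2 (by positivity)) (h1.trans hσ)
            (Finset.sum_nonneg fun _ _ => by positivity) (by positivity)
      _ = _ := by ring
  refine (Finset.sum_le_sum hstep).trans ?_
  rw [← Finset.mul_sum, Finset.sum_boole]
  refine mul_le_mul_of_nonneg_left ?_ hτ0
  exact_mod_cast card_mRange_filter_kerArg_le M hq₂ a₁ a₂ n₂

/-- The real `m`-sum casts to the complex one. [folklore] -/
theorem msum_real_cast (M : ℝ) (a₁ a₂ : ℤ) (q₁ q₂ n₁ n₂ : ℕ) :
    ((∑ m ∈ BFI.mRange M (M / 2), BFI.bump M (M / 2) m *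
        ((if kerArg a₁ a₂ q₁ m n₁ = 1 then (1 : ℝ) else 0) *
          (if kerArg a₁ a₂ q₂ m n₂ = 1 then (1 : ℝ) else 0)) : ℝ) : ℂ) =
      ∑ m ∈ BFI.mRange M (M / 2), ((BFI.bump M (M / 2) m : ℝ) : ℂ) *
        (if kerArg a₁ a₂ q₁ m n₁ = 1 then 1 else 0) * (if kerArg a₁ a₂ q₂ m n₂ = 1 then 1 else 0) := by
  rw [Complex.ofReal_sum]
  refine Finset.sum_congr rfl fun m _ => ?_
  rw [mul_assoc]
  push_cast
  congr 1
  split_ifs <;> simp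

/-- **Compatibility**: the `m`-sum vanishes unless `n₁ ≡ n₂ (mod (q₁,q₂))` (`a₁, a₂` units modulo
`q₁, q₂`). [cite: Drappeau2017, §5.4] -/
theorem msum_real_eq_zero {q₁ q₂ : ℕ} (hq₁ : 0 < q₁) (hq₂ : 0 < q₂) {a₁ a₂ : ℤ}
    (ha₁ : IsUnit (a₁ : ZMod q₁)) (ha₁' : IsUnit (a₁ : ZMod q₂))
    (ha₂ : IsUnit (a₂ : ZMod q₁)) (ha₂' : IsUnit (a₂ : ZMod q₂)) {n₁ n₂ : ℕ}
    (h : ¬ (n₁ : ZMod (Nat.gcd q₁ q₂)) = (n₂ : ZMod (Nat.gcd q₁ q₂))) {M : ℝ} (hM : 0 < M) :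
    ∑ m ∈ BFI.mRange M (M / 2), BFI.bump M (M / 2) m *
        ((if kerArg a₁ a₂ q₁ m n₁ = 1 then (1 : ℝ) else 0) *
          (if kerArg a₁ a₂ q₂ m n₂ = 1 then (1 : ℝ) else 0)) = 0 := by
  have hc := msum_real_cast M a₁ a₂ q₁ q₂ n₁ n₂
  rw [msum_dispS1_eq hq₁ hq₂ ha₁ ha₁' n₁ n₂ hM] at hc
  have hcard := card_range_lcm_filter_eq hq₁ hq₂ ha₁ ha₁' ha₂ ha₂' n₁ n₂
  rw [if_neg (fun h' => h h'.2.2), Finset.card_eq_zero] at hcard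
  rw [hcard, Finset.sum_empty, Complex.ofReal_eq_zero] at hc
  exact hc

/-- **Drappeau 2017, §5.4: the trivial bound for the piece `𝒮₁(q₀,n₀)`** (physical side).  For moduli
`𝒬'` (all `≥ 1`, coprime to `a₁a₂`, `|γ| ≤ 1`), `n`'s in `𝒩'` with `|β_n| ≤ B`, any `q₀, n₀`, and the
divisor bound `τ(|m n₁ a₂ − a₁|) ≤ τM` (`m n₁a₂ ≠ a₁`) on the support of `α`:
`|∑_{q₁,q₂} γγ ∑_{n₁,n₂} 1_{(q₁,q₂)=q₀,(n₁,n₂)=n₀} ββ̄ ∑_m α 1·1|`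
`≤ τM B² (∑_{q₂ ∈ 𝒬', q₀∣q₂} (⌊5M/2⌋/q₂ + 1)) · #{(n₁,n₂) ∈ 𝒩'² : n₀ ∣ n₁, n₀ ∣ n₂, n₁ ≡ n₂ (q₀)}`
(printed: `|𝒮₁(q₀,n₀)| ≪ x^ε {MN²/(n₀²q₀²) + MN/(n₀q₀)}`). [cite: Drappeau2017, §5.4] -/
theorem norm_S1piece_le {𝒬' : Finset ℕ} {a₁ a₂ : ℤ}
    (h𝒬' : ∀ q ∈ 𝒬', 0 < q ∧ IsCoprime (q : ℤ) (a₁ * a₂)) {γ : ℕ → ℝ} (hγ : ∀ q, |γ q| ≤ 1)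
    (𝒩' : Finset ℕ) {β : ℕ → ℂ} {B : ℝ} (hB0 : 0 ≤ B) (hβ : ∀ n ∈ 𝒩', ‖β n‖ ≤ B)
    (q₀ n₀ : ℕ) {M : ℝ} (hM : 0 < M) {τM : ℝ} (hτ0 : 0 ≤ τM)
    (hτ : ∀ m ∈ BFI.mRange M (M / 2), BFI.bump M (M / 2) m ≠ 0 → ∀ n₁ ∈ 𝒩',
      (m : ℤ) * n₁ * a₂ - a₁ ≠ 0 ∧ (σ 0 (Int.natAbs ((m : ℤ) * n₁ * a₂ - a₁)) : ℝ) ≤ τM) :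
    ‖∑ q₁ ∈ 𝒬', ∑ q₂ ∈ 𝒬', (γ q₁ : ℂ) * (γ q₂ : ℂ) * ∑ n₁ ∈ 𝒩', ∑ n₂ ∈ 𝒩',
        (if (Nat.gcd q₁ q₂ = q₀ ∧ Nat.gcd n₁ n₂ = n₀) then (1 : ℂ) else 0) *
          (β n₁ * starRingEnd ℂ (β n₂)) *
        ∑ m ∈ BFI.mRange M (M / 2), ((BFI.bump M (M / 2) m : ℝ) : ℂ) *
          (if kerArg a₁ a₂ q₁ m n₁ = 1 then 1 else 0) * (if kerArg a₁ a₂ q₂ m n₂ = 1 then 1 else 0)‖ ≤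
      τM * B ^ 2 * (∑ q₂ ∈ 𝒬'.filter (fun q : ℕ => q₀ ∣ q), ((((⌊2 * M + M / 2⌋₊ / q₂ : ℕ)) : ℝ) + 1)) *
        (((𝒩' ×ˢ 𝒩').filter (fun p : ℕ × ℕ =>
          n₀ ∣ p.1 ∧ n₀ ∣ p.2 ∧ (p.1 : ZMod q₀) = (p.2 : ZMod q₀))).card : ℝ) := by
  -- abbreviations: the real `m`-sum and the `n`-condition
  set msR : ℕ → ℕ → ℕ → ℕ → ℝ := fun q₁ q₂ n₁ n₂ => ∑ m ∈ BFI.mRange M (M / 2), BFI.bump M (M / 2) m *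
    ((if kerArg a₁ a₂ q₁ m n₁ = 1 then (1 : ℝ) else 0) *
      (if kerArg a₁ a₂ q₂ m n₂ = 1 then (1 : ℝ) else 0)) with hmsR
  have hM2 : (0 : ℝ) < M / 2 := by linarith
  have hmsR0 : ∀ q₁ q₂ n₁ n₂, 0 ≤ msR q₁ q₂ n₁ n₂ := fun q₁ q₂ n₁ n₂ =>
    Finset.sum_nonneg fun m _ => mul_nonneg (BFI.bump_mem_Icc hM2 hM.le _).1 (by positivity)
  set cond : ℕ → ℕ → Prop := fun n₁ n₂ => n₀ ∣ n₁ ∧ n₀ ∣ n₂ ∧ (n₁ : ZMod q₀) = (n₂ : ZMod q₀)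
    with hcond
  -- (1) termwise: `‖γγ · wt ββ̄ msum‖ ≤ B² · 1_{q₀ ∣ q₂} 1_{cond} · msR`
  have hterm : ∀ q₁ ∈ 𝒬', ∀ q₂ ∈ 𝒬', ∀ n₁ ∈ 𝒩', ∀ n₂ ∈ 𝒩',
      ‖(γ q₁ : ℂ) * (γ q₂ : ℂ) * ((if (Nat.gcd q₁ q₂ = q₀ ∧ Nat.gcd n₁ n₂ = n₀) then (1 : ℂ) else 0) *
          (β n₁ * starRingEnd ℂ (β n₂)) *
        ∑ m ∈ BFI.mRange M (M / 2), ((BFI.bump M (M / 2) m : ℝ) : ℂ) *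
          (if kerArg a₁ a₂ q₁ m n₁ = 1 then 1 else 0) * (if kerArg a₁ a₂ q₂ m n₂ = 1 then 1 else 0))‖ ≤
      B ^ 2 * ((if q₀ ∣ q₂ then (1 : ℝ) else 0) * (if cond n₁ n₂ then (1 : ℝ) else 0) *
        msR q₁ q₂ n₁ n₂) := by
    intro q₁ hq₁ q₂ hq₂ n₁ hn₁ n₂ hn₂
    obtain ⟨hq₁0, hc₁⟩ := h𝒬' q₁ hq₁
    obtain ⟨hq₂0, hc₂⟩ := h𝒬' q₂ hq₂
    obtain ⟨ha₁, ha₂⟩ := isUnit_of_isCoprime_mul hc₁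
    obtain ⟨ha₁', ha₂'⟩ := isUnit_of_isCoprime_mul hc₂
    have hγ1 : ‖(γ q₁ : ℂ)‖ * ‖(γ q₂ : ℂ)‖ ≤ 1 := by
      rw [Complex.norm_real, Complex.norm_real, Real.norm_eq_abs, Real.norm_eq_abs]
      exact mul_le_one₀ (hγ q₁) (abs_nonneg _) (hγ q₂)
    have hββ : ‖β n₁ * starRingEnd ℂ (β n₂)‖ ≤ B ^ 2 := by
      rw [norm_mul, Complex.norm_conj, sq]
      exact mul_le_mul (hβ n₁ hn₁) (hβ n₂ hn₂) (norm_nonneg _) hB0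
    have hms := norm_msum_le_real hM a₁ a₂ q₁ q₂ n₁ n₂
    have hRHS0 : 0 ≤ B ^ 2 * ((if q₀ ∣ q₂ then (1 : ℝ) else 0) * (if cond n₁ n₂ then (1 : ℝ) else 0) *
        msR q₁ q₂ n₁ n₂) :=
      mul_nonneg (sq_nonneg _) (mul_nonneg (mul_nonneg (by positivity) (by positivity))
        (hmsR0 _ _ _ _))
    by_cases hw : (Nat.gcd q₁ q₂ = q₀ ∧ Nat.gcd n₁ n₂ = n₀)
    · rw [if_pos hw, one_mul]
      have hq₀q₂ : q₀ ∣ q₂ := hw.1 ▸ Nat.gcd_dvd_right q₁ q₂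
      rw [if_pos hq₀q₂, one_mul, norm_mul, norm_mul, norm_mul]
      by_cases hc : cond n₁ n₂
      · rw [if_pos hc, one_mul]
        calc _ ≤ 1 * (B ^ 2 * msR q₁ q₂ n₁ n₂) :=
              mul_le_mul hγ1 (mul_le_mul hββ hms (norm_nonneg _) (by positivity)) (by positivity)
                zero_le_one
          _ = _ := by ring
      · -- `cond` fails only through the congruence: then the `m`-sum vanishes
        have hn₀ : n₀ ∣ n₁ ∧ n₀ ∣ n₂ := by
          rw [← hw.2]; exact ⟨Nat.gcd_dvd_left _ _, Nat.gcd_dvd_right _ _⟩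
        have hne : ¬ (n₁ : ZMod (Nat.gcd q₁ q₂)) = (n₂ : ZMod (Nat.gcd q₁ q₂)) := by
          rw [hw.1]; exact fun h' => hc ⟨hn₀.1, hn₀.2, h'⟩
        have h0 := msum_real_eq_zero hq₁0 hq₂0 ha₁ ha₁' ha₂ ha₂' hne hM
        have hms0 : ‖∑ m ∈ BFI.mRange M (M / 2), ((BFI.bump M (M / 2) m : ℝ) : ℂ) *
            (if kerArg a₁ a₂ q₁ m n₁ = 1 then 1 else 0) *
            (if kerArg a₁ a₂ q₂ m n₂ = 1 then 1 else 0)‖ = 0 := by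
          rw [← msum_real_cast, h0, Complex.ofReal_zero, norm_zero]
        rw [hms0, if_neg hc]
        simp
    · rw [if_neg hw]
      simp only [zero_mul, mul_zero, norm_zero]
      exact hRHS0
  -- (2) sum the termwise bounds
  calc _ ≤ ∑ q₁ ∈ 𝒬', ∑ q₂ ∈ 𝒬', ∑ n₁ ∈ 𝒩', ∑ n₂ ∈ 𝒩',
        B ^ 2 * ((if q₀ ∣ q₂ then (1 : ℝ) else 0) * (if cond n₁ n₂ then (1 : ℝ) else 0) *
          msR q₁ q₂ n₁ n₂) := by
        refine (norm_sum_le _ _).trans (Finset.sum_le_sum fun q₁ hq₁ => ?_)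
        refine (norm_sum_le _ _).trans (Finset.sum_le_sum fun q₂ hq₂ => ?_)
        rw [Finset.mul_sum]
        refine (norm_sum_le _ _).trans (Finset.sum_le_sum fun n₁ hn₁ => ?_)
        rw [Finset.mul_sum]
        refine (norm_sum_le _ _).trans (Finset.sum_le_sum fun n₂ hn₂ => ?_)
        exact hterm q₁ hq₁ q₂ hq₂ n₁ hn₁ n₂ hn₂
    _ = B ^ 2 * ∑ q₂ ∈ 𝒬', (if q₀ ∣ q₂ then (1 : ℝ) else 0) *
          ∑ n₁ ∈ 𝒩', ∑ n₂ ∈ 𝒩', (if cond n₁ n₂ then (1 : ℝ) else 0) *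
            ∑ q₁ ∈ 𝒬', msR q₁ q₂ n₁ n₂ := by
        rw [Finset.sum_comm, Finset.mul_sum]
        refine Finset.sum_congr rfl fun q₂ _ => ?_
        rw [Finset.mul_sum, Finset.mul_sum, Finset.sum_comm]
        refine Finset.sum_congr rfl fun n₁ _ => ?_
        rw [Finset.mul_sum, Finset.mul_sum, Finset.sum_comm]
        refine Finset.sum_congr rfl fun n₂ _ => ?_
        rw [Finset.mul_sum, Finset.mul_sum, Finset.mul_sum]
        refine Finset.sum_congr rfl fun q₁ _ => by ring
    _ ≤ B ^ 2 * ∑ q₂ ∈ 𝒬', (if q₀ ∣ q₂ then (1 : ℝ) else 0) *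
          ∑ n₁ ∈ 𝒩', ∑ n₂ ∈ 𝒩', (if cond n₁ n₂ then (1 : ℝ) else 0) *
            (τM * ((((⌊2 * M + M / 2⌋₊ / q₂ : ℕ)) : ℝ) + 1)) := by
        refine mul_le_mul_of_nonneg_left (Finset.sum_le_sum fun q₂ hq₂ => ?_) (by positivity)
        refine mul_le_mul_of_nonneg_left (Finset.sum_le_sum fun n₁ hn₁ =>
          Finset.sum_le_sum fun n₂ _ => ?_) (by positivity)
        refine mul_le_mul_of_nonneg_left ?_ (by positivity)
        exact sum_msum_real_le h𝒬' (h𝒬' q₂ hq₂).1 hM n₂ hτ0 (fun m hm hb => hτ m hm hb n₁ hn₁)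
    _ = _ := by
        rw [Finset.sum_filter]
        have hpairs : ∑ n₁ ∈ 𝒩', ∑ n₂ ∈ 𝒩', (if cond n₁ n₂ then (1 : ℝ) else 0) =
            (((𝒩' ×ˢ 𝒩').filter (fun p : ℕ × ℕ =>
              n₀ ∣ p.1 ∧ n₀ ∣ p.2 ∧ (p.1 : ZMod q₀) = (p.2 : ZMod q₀))).card : ℝ) := by
          rw [← Finset.sum_product', Finset.sum_boole]
        simp_rw [← Finset.sum_mul]
        rw [hpairs]
        have e : ∀ q₂ ∈ 𝒬', (if q₀ ∣ q₂ then (1 : ℝ) else 0) *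
            ((((𝒩' ×ˢ 𝒩').filter (fun p : ℕ × ℕ =>
              n₀ ∣ p.1 ∧ n₀ ∣ p.2 ∧ (p.1 : ZMod q₀) = (p.2 : ZMod q₀))).card : ℝ) *
              (τM * ((((⌊2 * M + M / 2⌋₊ / q₂ : ℕ)) : ℝ) + 1))) =
            (if q₀ ∣ q₂ then ((((⌊2 * M + M / 2⌋₊ / q₂ : ℕ)) : ℝ) + 1) else 0) *
              ((((𝒩' ×ˢ 𝒩').filter (fun p : ℕ × ℕ =>
                n₀ ∣ p.1 ∧ n₀ ∣ p.2 ∧ (p.1 : ZMod q₀) = (p.2 : ZMod q₀))).card : ℝ) * τM) := by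
          intro q₂ _
          split_ifs <;> ring
        rw [Finset.sum_congr rfl e, ← Finset.sum_mul]
        ring

/-! ### The trivial bound for the piece `X₁(q₀,n₀)` -/

/-- `1/[q₁,q₂] = (q₁,q₂)/(q₁q₂)` for `q₁, q₂ ≥ 1`. [folklore] -/
theorem inv_lcm_eq {q₁ q₂ : ℕ} (hq₁ : 0 < q₁) (hq₂ : 0 < q₂) :
    ((Nat.lcm q₁ q₂ : ℝ))⁻¹ = (Nat.gcd q₁ q₂ : ℝ) / ((q₁ : ℝ) * q₂) := by
  have h := Nat.gcd_mul_lcm q₁ q₂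
  have hl : (0 : ℝ) < Nat.lcm q₁ q₂ := by exact_mod_cast Nat.lcm_pos hq₁ hq₂
  have hq : (0 : ℝ) < (q₁ : ℝ) * q₂ := by positivity
  have h' : (Nat.gcd q₁ q₂ : ℝ) * (Nat.lcm q₁ q₂ : ℝ) = (q₁ : ℝ) * q₂ := by exact_mod_cast h
  rw [eq_div_iff hq.ne', ← h']
  field_simp

/-- **Drappeau 2017, §5.4: the trivial bound for the piece `X₁(q₀,n₀)`** of the main term: for
`𝒬' ⊆ [1, L]`, `|γ| ≤ 1`, `|β_n| ≤ B` on `𝒩'`, `q₀ ≥ 1`: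
`|∑_{q₁,q₂} (γγ/[q₁,q₂]) ∑_{(n_j,q_j)=1} 1_{n₁≡n₂ ((q₁,q₂))} 1_{(q₁,q₂)=q₀,(n₁,n₂)=n₀} ββ̄|`
`≤ B² (1 + log L)²/q₀ · #{(n₁,n₂) ∈ 𝒩'² : n₀ ∣ n₁, n₀ ∣ n₂, n₁ ≡ n₂ (q₀)}`
(printed: `|X₁(q₀,n₀)| ≪ x^ε (N/(q₀n₀))(N/(q₀n₀) + 1)`). [cite: Drappeau2017, §5.4] -/
theorem norm_X1piece_le {𝒬' : Finset ℕ} {L : ℕ} (h𝒬'L : 𝒬' ⊆ Icc 1 L) {γ : ℕ → ℝ}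
    (hγ : ∀ q, |γ q| ≤ 1) (𝒩' : Finset ℕ) {β : ℕ → ℂ} {B : ℝ} (hB0 : 0 ≤ B)
    (hβ : ∀ n ∈ 𝒩', ‖β n‖ ≤ B) {q₀ : ℕ} (hq₀ : 0 < q₀) (n₀ : ℕ) :
    ‖∑ q₁ ∈ 𝒬', ∑ q₂ ∈ 𝒬', ((γ q₁ * γ q₂ / (Nat.lcm q₁ q₂ : ℝ) : ℝ) : ℂ) *
        ∑ n₁ ∈ 𝒩'.filter (fun n => n.Coprime q₁), ∑ n₂ ∈ 𝒩'.filter (fun n => n.Coprime q₂),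
          (if (n₁ : ZMod (Nat.gcd q₁ q₂)) = (n₂ : ZMod (Nat.gcd q₁ q₂)) then
            (if (Nat.gcd q₁ q₂ = q₀ ∧ Nat.gcd n₁ n₂ = n₀) then (1 : ℂ) else 0) *
              (β n₁ * starRingEnd ℂ (β n₂)) else 0)‖ ≤
      B ^ 2 * ((1 + Real.log L) ^ 2 / q₀) *
        (((𝒩' ×ˢ 𝒩').filter (fun p : ℕ × ℕ =>
          n₀ ∣ p.1 ∧ n₀ ∣ p.2 ∧ (p.1 : ZMod q₀) = (p.2 : ZMod q₀))).card : ℝ) := by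
  set cond : ℕ → ℕ → Prop := fun n₁ n₂ => n₀ ∣ n₁ ∧ n₀ ∣ n₂ ∧ (n₁ : ZMod q₀) = (n₂ : ZMod q₀)
    with hcond
  set P : ℝ := (((𝒩' ×ˢ 𝒩').filter (fun p : ℕ × ℕ =>
      n₀ ∣ p.1 ∧ n₀ ∣ p.2 ∧ (p.1 : ZMod q₀) = (p.2 : ZMod q₀))).card : ℝ) with hPdef
  have hpairs : ∑ n₁ ∈ 𝒩', ∑ n₂ ∈ 𝒩', (if cond n₁ n₂ then (1 : ℝ) else 0) = P := by
    rw [hPdef, ← Finset.sum_product', Finset.sum_boole]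
  have hP0 : 0 ≤ P := Nat.cast_nonneg _
  have hlog0 : 0 ≤ 1 + Real.log L := by
    have := Real.log_natCast_nonneg L; linarith
  -- the `n`-sums of one pair `(q₁, q₂)`
  have hn : ∀ q₁ ∈ 𝒬', ∀ q₂ ∈ 𝒬',
      ‖∑ n₁ ∈ 𝒩'.filter (fun n => n.Coprime q₁), ∑ n₂ ∈ 𝒩'.filter (fun n => n.Coprime q₂),
          (if (n₁ : ZMod (Nat.gcd q₁ q₂)) = (n₂ : ZMod (Nat.gcd q₁ q₂)) then
            (if (Nat.gcd q₁ q₂ = q₀ ∧ Nat.gcd n₁ n₂ = n₀) then (1 : ℂ) else 0) *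
              (β n₁ * starRingEnd ℂ (β n₂)) else 0)‖ ≤
      (if Nat.gcd q₁ q₂ = q₀ then (1 : ℝ) else 0) * (B ^ 2 * P) := by
    intro q₁ _ q₂ _
    by_cases hg : Nat.gcd q₁ q₂ = q₀
    · rw [if_pos hg, one_mul]
      calc _ ≤ ∑ n₁ ∈ 𝒩'.filter (fun n => n.Coprime q₁), ∑ n₂ ∈ 𝒩'.filter (fun n => n.Coprime q₂),
            B ^ 2 * (if cond n₁ n₂ then (1 : ℝ) else 0) := by
            refine (norm_sum_le _ _).trans (Finset.sum_le_sum fun n₁ hn₁ => ?_)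
            refine (norm_sum_le _ _).trans (Finset.sum_le_sum fun n₂ hn₂ => ?_)
            have hn₁' := (Finset.mem_filter.1 hn₁).1
            have hn₂' := (Finset.mem_filter.1 hn₂).1
            by_cases h1 : (n₁ : ZMod (Nat.gcd q₁ q₂)) = (n₂ : ZMod (Nat.gcd q₁ q₂))
            · rw [if_pos h1]
              by_cases h2 : (Nat.gcd q₁ q₂ = q₀ ∧ Nat.gcd n₁ n₂ = n₀)
              · rw [if_pos h2, one_mul]
                have hc : cond n₁ n₂ := by
                  refine ⟨h2.2 ▸ Nat.gcd_dvd_left n₁ n₂, h2.2 ▸ Nat.gcd_dvd_right n₁ n₂, ?_⟩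
                  rw [← hg]; exact h1
                rw [if_pos hc, mul_one, norm_mul, Complex.norm_conj, sq]
                exact mul_le_mul (hβ n₁ hn₁') (hβ n₂ hn₂') (norm_nonneg _) hB0
              · rw [if_neg h2, zero_mul, norm_zero]; positivity
            · rw [if_neg h1, norm_zero]; positivity
        _ ≤ ∑ n₁ ∈ 𝒩', ∑ n₂ ∈ 𝒩', B ^ 2 * (if cond n₁ n₂ then (1 : ℝ) else 0) := by
            refine (Finset.sum_le_sum_of_subset_of_nonneg (Finset.filter_subset _ _)
              fun _ _ _ => Finset.sum_nonneg fun _ _ => by positivity).trans ?_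
            exact Finset.sum_le_sum fun n₁ _ => Finset.sum_le_sum_of_subset_of_nonneg
              (Finset.filter_subset _ _) fun _ _ _ => by positivity
        _ = B ^ 2 * P := by
            rw [← hpairs, Finset.mul_sum]
            refine Finset.sum_congr rfl fun n₁ _ => by rw [Finset.mul_sum]
    · rw [if_neg hg, zero_mul]
      refine le_of_eq ?_
      rw [norm_eq_zero]
      refine Finset.sum_eq_zero fun n₁ _ => Finset.sum_eq_zero fun n₂ _ => ?_
      rw [if_neg (show ¬(Nat.gcd q₁ q₂ = q₀ ∧ Nat.gcd n₁ n₂ = n₀) from fun h => hg h.1), zero_mul,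
        ite_self]
  -- the `q`-sums
  have hq : ∀ q₁ ∈ 𝒬', ∀ q₂ ∈ 𝒬',
      ‖((γ q₁ * γ q₂ / (Nat.lcm q₁ q₂ : ℝ) : ℝ) : ℂ)‖ * ((if Nat.gcd q₁ q₂ = q₀ then (1 : ℝ) else 0) *
        (B ^ 2 * P)) ≤
      (q₀ : ℝ) * (((if q₀ ∣ q₁ then ((q₁ : ℝ))⁻¹ else 0) * (if q₀ ∣ q₂ then ((q₂ : ℝ))⁻¹ else 0)) *
        (B ^ 2 * P)) := by
    intro q₁ hq₁ q₂ hq₂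
    have hq₁' := Finset.mem_Icc.1 (h𝒬'L hq₁)
    have hq₂' := Finset.mem_Icc.1 (h𝒬'L hq₂)
    by_cases hg : Nat.gcd q₁ q₂ = q₀
    · have hd₁ : q₀ ∣ q₁ := hg ▸ Nat.gcd_dvd_left q₁ q₂
      have hd₂ : q₀ ∣ q₂ := hg ▸ Nat.gcd_dvd_right q₁ q₂
      rw [if_pos hg, if_pos hd₁, if_pos hd₂, one_mul, Complex.norm_real, Real.norm_eq_abs, abs_div,
        abs_mul, Nat.abs_cast]
      have h1 : |γ q₁| * |γ q₂| / (Nat.lcm q₁ q₂ : ℝ) ≤ 1 * ((Nat.lcm q₁ q₂ : ℝ))⁻¹ := by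
        rw [div_eq_mul_inv]
        exact mul_le_mul_of_nonneg_right (mul_le_one₀ (hγ q₁) (abs_nonneg _) (hγ q₂))
          (by positivity)
      rw [one_mul, inv_lcm_eq hq₁'.1 hq₂'.1, hg] at h1
      calc _ ≤ ((q₀ : ℝ) / ((q₁ : ℝ) * q₂)) * (B ^ 2 * P) :=
            mul_le_mul_of_nonneg_right h1 (by positivity)
        _ = _ := by
            have hq₁0 : (q₁ : ℝ) ≠ 0 := by exact_mod_cast (Nat.pos_of_ne_zero (by omega)).ne'
            have hq₂0 : (q₂ : ℝ) ≠ 0 := by exact_mod_cast (Nat.pos_of_ne_zero (by omega)).ne'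
            field_simp
    · rw [if_neg hg, zero_mul, mul_zero]
      positivity
  calc _ ≤ ∑ q₁ ∈ 𝒬', ∑ q₂ ∈ 𝒬', ‖((γ q₁ * γ q₂ / (Nat.lcm q₁ q₂ : ℝ) : ℝ) : ℂ)‖ *
        ((if Nat.gcd q₁ q₂ = q₀ then (1 : ℝ) else 0) * (B ^ 2 * P)) := by
        refine (norm_sum_le _ _).trans (Finset.sum_le_sum fun q₁ hq₁ => ?_)
        refine (norm_sum_le _ _).trans (Finset.sum_le_sum fun q₂ hq₂ => ?_)
        rw [norm_mul]
        exact mul_le_mul_of_nonneg_left (hn q₁ hq₁ q₂ hq₂) (norm_nonneg _)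
    _ ≤ ∑ q₁ ∈ 𝒬', ∑ q₂ ∈ 𝒬', (q₀ : ℝ) * (((if q₀ ∣ q₁ then ((q₁ : ℝ))⁻¹ else 0) *
        (if q₀ ∣ q₂ then ((q₂ : ℝ))⁻¹ else 0)) * (B ^ 2 * P)) :=
        Finset.sum_le_sum fun q₁ hq₁ => Finset.sum_le_sum fun q₂ hq₂ => hq q₁ hq₁ q₂ hq₂
    _ = (q₀ : ℝ) * (B ^ 2 * P) * ((∑ q ∈ 𝒬'.filter (fun q => q₀ ∣ q), ((q : ℝ))⁻¹) *
          ∑ q ∈ 𝒬'.filter (fun q => q₀ ∣ q), ((q : ℝ))⁻¹) := by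
        rw [Finset.sum_filter, Finset.sum_mul_sum, Finset.mul_sum]
        refine Finset.sum_congr rfl fun q₁ _ => ?_
        rw [Finset.mul_sum]
        refine Finset.sum_congr rfl fun q₂ _ => by ring
    _ ≤ (q₀ : ℝ) * (B ^ 2 * P) * (((1 + Real.log L) / q₀) * ((1 + Real.log L) / q₀)) := by
        have h1 := sum_filter_dvd_inv_le h𝒬'L (Nat.one_le_iff_ne_zero.2 hq₀.ne')
        have h0 : 0 ≤ ∑ q ∈ 𝒬'.filter (fun q => q₀ ∣ q), ((q : ℝ))⁻¹ :=
          Finset.sum_nonneg fun _ _ => by positivity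
        exact mul_le_mul_of_nonneg_left (mul_le_mul h1 h1 h0 (by positivity)) (by positivity)
    _ = _ := by
        have hq₀r : (q₀ : ℝ) ≠ 0 := by exact_mod_cast hq₀.ne'
        field_simp

/-! ### Counting the pairs `(n₁, n₂)` -/

/-- **The pairs `(n₁,n₂)`** with `n₀ ∣ n_j`, `n₁ ≡ n₂ (q₀)`, `n_j ≤ X` (`(n₀,q₀) = 1`): at most
`(X/n₀ + 1)(X/(n₀q₀) + 1)` of them (`n₂` lies in one class modulo `n₀q₀`).
[cite: Drappeau2017, §5.4] -/
theorem card_pairs_le {𝒩' : Finset ℕ} {X : ℕ} (h𝒩' : ∀ n ∈ 𝒩', n ≤ X) {n₀ q₀ : ℕ} (hn₀ : 0 < n₀)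
    (hq₀ : 0 < q₀) (hcop : Nat.Coprime n₀ q₀) :
    ((𝒩' ×ˢ 𝒩').filter (fun p : ℕ × ℕ =>
        n₀ ∣ p.1 ∧ n₀ ∣ p.2 ∧ (p.1 : ZMod q₀) = (p.2 : ZMod q₀))).card ≤
      (X / n₀ + 1) * (X / (n₀ * q₀) + 1) := by
  haveI : NeZero n₀ := ⟨hn₀.ne'⟩
  have hnq : 0 < n₀ * q₀ := Nat.mul_pos hn₀ hq₀
  -- fibres
  have hcard : ((𝒩' ×ˢ 𝒩').filter (fun p : ℕ × ℕ =>
      n₀ ∣ p.1 ∧ n₀ ∣ p.2 ∧ (p.1 : ZMod q₀) = (p.2 : ZMod q₀))).card =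
      ∑ n₁ ∈ 𝒩', (𝒩'.filter (fun n₂ : ℕ =>
        n₀ ∣ n₁ ∧ n₀ ∣ n₂ ∧ (n₁ : ZMod q₀) = (n₂ : ZMod q₀))).card := by
    rw [Finset.card_filter, Finset.sum_product]
    refine Finset.sum_congr rfl fun n₁ _ => ?_
    rw [Finset.card_filter]
  rw [hcard]
  have hfib : ∀ n₁ ∈ 𝒩', (𝒩'.filter (fun n₂ : ℕ =>
      n₀ ∣ n₁ ∧ n₀ ∣ n₂ ∧ (n₁ : ZMod q₀) = (n₂ : ZMod q₀))).card ≤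
      (if n₀ ∣ n₁ then 1 else 0) * (X / (n₀ * q₀) + 1) := by
    intro n₁ _
    by_cases hd : n₀ ∣ n₁
    · rw [if_pos hd, one_mul]
      set F := 𝒩'.filter (fun n₂ : ℕ => n₀ ∣ n₁ ∧ n₀ ∣ n₂ ∧ (n₁ : ZMod q₀) = (n₂ : ZMod q₀))
        with hF
      rcases F.eq_empty_or_nonempty with hF0 | ⟨m, hm⟩
      · rw [hF0, Finset.card_empty]; exact Nat.zero_le _
      · have hm' := (Finset.mem_filter.1 hm).2
        refine le_trans (Finset.card_le_card ?_) (card_filter_natCast_eq_le h𝒩' hnq (m : ZMod (n₀ * q₀)))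
        intro n₂ hn₂
        have hn₂' := Finset.mem_filter.1 hn₂
        rw [Finset.mem_filter]
        refine ⟨hn₂'.1, ?_⟩
        rw [ZMod.natCast_eq_natCast_iff]
        refine (Nat.modEq_and_modEq_iff_modEq_mul hcop).1 ⟨?_, ?_⟩
        · exact (Nat.modEq_zero_iff_dvd.2 hn₂'.2.2.1).trans (Nat.modEq_zero_iff_dvd.2 hm'.2.1).symm
        · rw [← ZMod.natCast_eq_natCast_iff]
          rw [← hn₂'.2.2.2, ← hm'.2.2]
    · rw [if_neg hd, zero_mul]
      refine le_of_eq (Finset.card_eq_zero.2 (Finset.filter_eq_empty_iff.2 fun n₂ _ h => hd h.1))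
  refine (Finset.sum_le_sum hfib).trans ?_
  rw [← Finset.sum_mul, Finset.sum_boole]
  refine Nat.mul_le_mul_right _ ?_
  refine le_trans (Finset.card_le_card fun n hn => ?_) (card_filter_natCast_eq_le h𝒩' hn₀ (0 : ZMod n₀))
  rw [Finset.mem_filter] at hn ⊢
  exact ⟨hn.1, (ZMod.natCast_eq_zero_iff _ _).2 hn.2⟩

/-- **The moduli `q₂` divisible by `q₀`**: for `𝒬' ⊆ [1, L]`, `q₀ ≥ 1`, `X' ≥ 0`:
`∑_{q₂ ∈ 𝒬', q₀ ∣ q₂} (X'/q₂ + 1) ≤ X'(1 + log L)/q₀ + L/q₀`. [cite: Drappeau2017, §5.4] -/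
theorem sum_filter_dvd_div_add_one_le {𝒬' : Finset ℕ} {L : ℕ} (h𝒬'L : 𝒬' ⊆ Icc 1 L) {q₀ : ℕ}
    (hq₀ : 0 < q₀) (X' : ℕ) :
    ∑ q₂ ∈ 𝒬'.filter (fun q : ℕ => q₀ ∣ q), ((((X' / q₂ : ℕ)) : ℝ) + 1) ≤
      (X' : ℝ) * (1 + Real.log L) / q₀ + (L / q₀ : ℕ) := by
  rw [Finset.sum_add_distrib, Finset.sum_const, nsmul_eq_mul, mul_one]
  refine add_le_add ?_ ?_
  · calc ∑ q₂ ∈ 𝒬'.filter (fun q : ℕ => q₀ ∣ q), (((X' / q₂ : ℕ)) : ℝ)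
        ≤ ∑ q₂ ∈ 𝒬'.filter (fun q : ℕ => q₀ ∣ q), (X' : ℝ) * ((q₂ : ℝ))⁻¹ := by
          refine Finset.sum_le_sum fun q₂ _ => ?_
          rw [← div_eq_mul_inv]
          exact Nat.cast_div_le
      _ = (X' : ℝ) * ∑ q₂ ∈ 𝒬'.filter (fun q : ℕ => q₀ ∣ q), ((q₂ : ℝ))⁻¹ := by rw [Finset.mul_sum]
      _ ≤ (X' : ℝ) * ((1 + Real.log L) / q₀) :=
          mul_le_mul_of_nonneg_left (sum_filter_dvd_inv_le h𝒬'L (Nat.one_le_iff_ne_zero.2 hq₀.ne'))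
            (Nat.cast_nonneg _)
      _ = _ := by ring
  · -- the multiples of `q₀` in `[1, L]`
    have hsub : 𝒬'.filter (fun q : ℕ => q₀ ∣ q) ⊆ (Icc 1 (L / q₀)).image (fun k => q₀ * k) := by
      intro q hq
      rw [Finset.mem_filter] at hq
      obtain ⟨k, hk⟩ := hq.2
      have hq' := Finset.mem_Icc.1 (h𝒬'L hq.1)
      rw [Finset.mem_image]
      refine ⟨k, Finset.mem_Icc.2 ⟨?_, ?_⟩, hk.symm⟩
      · rcases Nat.eq_zero_or_pos k with h0 | hpos
        · subst h0; omega
        · exact hpos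
      · rw [Nat.le_div_iff_mul_le hq₀, mul_comm]; omega
    calc (((𝒬'.filter (fun q : ℕ => q₀ ∣ q)).card : ℕ) : ℝ)
        ≤ (((Icc 1 (L / q₀)).image (fun k => q₀ * k)).card : ℝ) := by
          exact_mod_cast Finset.card_le_card hsub
      _ ≤ ((Icc 1 (L / q₀)).card : ℝ) := by exact_mod_cast Finset.card_image_le
      _ = (L / q₀ : ℕ) := by simp

/-! ### Vanishing of the pieces with bad `(q₀, n₀)` -/

/-- The weight `1_{(q₁,q₂)=q₀,(n₁,n₂)=n₀}` forces `(q₀,a₁a₂) = (n₀,a₂) = 1` on the ranges of `𝒮₁`,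
and `(q₀,n₀) = 1` as soon as `(n₁,q₁) = 1`. [folklore] -/
theorem weight_good {𝒬' 𝒩' : Finset ℕ} {a₁ a₂ : ℤ}
    (h𝒬' : ∀ q ∈ 𝒬', 0 < q ∧ IsCoprime (q : ℤ) (a₁ * a₂)) (h𝒩' : ∀ n ∈ 𝒩', IsCoprime (n : ℤ) a₂)
    {q₀ n₀ q₁ q₂ n₁ n₂ : ℕ} (hq₁ : q₁ ∈ 𝒬') (hn₁ : n₁ ∈ 𝒩')
    (hw : Nat.gcd q₁ q₂ = q₀ ∧ Nat.gcd n₁ n₂ = n₀) (hcop : Nat.Coprime n₁ q₁) :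
    Nat.Coprime q₀ n₀ ∧ IsCoprime (q₀ : ℤ) (a₁ * a₂) ∧ IsCoprime (n₀ : ℤ) a₂ := by
  have hd₁ : q₀ ∣ q₁ := hw.1 ▸ Nat.gcd_dvd_left q₁ q₂
  have hd₂ : n₀ ∣ n₁ := hw.2 ▸ Nat.gcd_dvd_left n₁ n₂
  refine ⟨?_, ?_, ?_⟩
  · exact ((hcop.coprime_dvd_left hd₂).coprime_dvd_right hd₁).symm
  · exact (h𝒬' q₁ hq₁).2.of_isCoprime_of_dvd_left (Int.natCast_dvd_natCast.2 hd₁)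
  · exact (h𝒩' n₁ hn₁).of_isCoprime_of_dvd_left (Int.natCast_dvd_natCast.2 hd₂)

/-- **The piece `𝒮₁(q₀,n₀)` vanishes for bad `(q₀,n₀)`** (`(q₀,n₀) > 1`, or `(q₀,a₁a₂) > 1`, or
`(n₀,a₂) > 1`). [cite: Drappeau2017, §5.4–5.5] -/
theorem S1piece_eq_zero {𝒬' 𝒩' : Finset ℕ} {a₁ a₂ : ℤ}
    (h𝒬' : ∀ q ∈ 𝒬', 0 < q ∧ IsCoprime (q : ℤ) (a₁ * a₂)) (h𝒩' : ∀ n ∈ 𝒩', IsCoprime (n : ℤ) a₂)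
    (γ : ℕ → ℝ) (β : ℕ → ℂ) {q₀ n₀ : ℕ} (M : ℝ)
    (hbad : ¬ (Nat.Coprime q₀ n₀ ∧ IsCoprime (q₀ : ℤ) (a₁ * a₂) ∧ IsCoprime (n₀ : ℤ) a₂)) :
    ∑ q₁ ∈ 𝒬', ∑ q₂ ∈ 𝒬', (γ q₁ : ℂ) * (γ q₂ : ℂ) * ∑ n₁ ∈ 𝒩', ∑ n₂ ∈ 𝒩',
        (if (Nat.gcd q₁ q₂ = q₀ ∧ Nat.gcd n₁ n₂ = n₀) then (1 : ℂ) else 0) *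
          (β n₁ * starRingEnd ℂ (β n₂)) *
        ∑ m ∈ BFI.mRange M (M / 2), ((BFI.bump M (M / 2) m : ℝ) : ℂ) *
          (if kerArg a₁ a₂ q₁ m n₁ = 1 then 1 else 0) * (if kerArg a₁ a₂ q₂ m n₂ = 1 then 1 else 0) = 0 := by
  refine Finset.sum_eq_zero fun q₁ hq₁ => Finset.sum_eq_zero fun q₂ _ => ?_
  rw [mul_eq_zero]; right
  refine Finset.sum_eq_zero fun n₁ hn₁ => Finset.sum_eq_zero fun n₂ _ => ?_
  by_cases hw : (Nat.gcd q₁ q₂ = q₀ ∧ Nat.gcd n₁ n₂ = n₀)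
  · -- then no `m` satisfies the first congruence
    rw [mul_eq_zero]; right
    refine Finset.sum_eq_zero fun m _ => ?_
    have hne : ¬ kerArg a₁ a₂ q₁ m n₁ = 1 := by
      intro h
      obtain ⟨hq₁0, hc₁⟩ := h𝒬' q₁ hq₁
      have ha₁ : IsUnit (a₁ : ZMod q₁) := (isUnit_of_isCoprime_mul hc₁).1
      have h' := (kerArg_eq_one_iff a₁ a₂ ha₁ m n₁).1 h
      have hu : IsUnit ((n₁ : ZMod q₁) * (a₂ : ZMod q₁)) := isUnit_of_mul_isUnit_right (h' ▸ ha₁)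
      have hcop : Nat.Coprime n₁ q₁ := (ZMod.isUnit_iff_coprime n₁ q₁).1 (isUnit_of_mul_isUnit_left hu)
      exact hbad (weight_good h𝒬' h𝒩' hq₁ hn₁ hw hcop)
    rw [if_neg hne, mul_zero, zero_mul]
  · rw [if_neg hw, zero_mul, zero_mul]

/-- **The piece `X₁(q₀,n₀)` vanishes for bad `(q₀,n₀)`.** [cite: Drappeau2017, §5.4–5.5] -/
theorem X1piece_eq_zero {𝒬' 𝒩' : Finset ℕ} {a₁ a₂ : ℤ}
    (h𝒬' : ∀ q ∈ 𝒬', 0 < q ∧ IsCoprime (q : ℤ) (a₁ * a₂)) (h𝒩' : ∀ n ∈ 𝒩', IsCoprime (n : ℤ) a₂)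
    (γ : ℕ → ℝ) (β : ℕ → ℂ) {q₀ n₀ : ℕ}
    (hbad : ¬ (Nat.Coprime q₀ n₀ ∧ IsCoprime (q₀ : ℤ) (a₁ * a₂) ∧ IsCoprime (n₀ : ℤ) a₂)) :
    ∑ q₁ ∈ 𝒬', ∑ q₂ ∈ 𝒬', ((γ q₁ * γ q₂ / (Nat.lcm q₁ q₂ : ℝ) : ℝ) : ℂ) *
        ∑ n₁ ∈ 𝒩'.filter (fun n => n.Coprime q₁), ∑ n₂ ∈ 𝒩'.filter (fun n => n.Coprime q₂),
          (if (n₁ : ZMod (Nat.gcd q₁ q₂)) = (n₂ : ZMod (Nat.gcd q₁ q₂)) then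
            (if (Nat.gcd q₁ q₂ = q₀ ∧ Nat.gcd n₁ n₂ = n₀) then (1 : ℂ) else 0) *
              (β n₁ * starRingEnd ℂ (β n₂)) else 0) = 0 := by
  refine Finset.sum_eq_zero fun q₁ hq₁ => Finset.sum_eq_zero fun q₂ _ => ?_
  rw [mul_eq_zero]; right
  refine Finset.sum_eq_zero fun n₁ hn₁ => Finset.sum_eq_zero fun n₂ _ => ?_
  have hn₁' := Finset.mem_filter.1 hn₁
  split_ifs with h1 hw
  · exact absurd (weight_good h𝒬' h𝒩' hq₁ hn₁'.1 hw hn₁'.2) hbad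
  · rw [zero_mul]
  · rfl

end Drappeau2017

end Literature.NumberTheory.Sieve

end
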